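import Literature.AlgebraicGeometry.HodgeTheory.HodgeLociClosedOfQuasiProjective
import Literature.AlgebraicGeometry.HodgeTheory.HodgeGenericQbarDescentFiniteMonodromyInputs
import Summits.HodgeConjecture.HodgeConjecture.Theorems.Ring2AbelianAllAndreFibreProductPencils
import HarnessLib

/-!
# Route MarkmanPartnerTransport · crux `PicardThreeK3Squares` (stmt-HodgeConjecture-19652) — the analytic half of
# the RM locus, UNCONDITIONAL for families with quasi-projective total space: the locus where a flat class of `H⁴`
# of the FIBRE SQUARES stays in `Fʳ` is CLOSED (Voisin II Lemma 5.13, Griffiths' theorem a tree theorem)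

Cell hodge-nonav, prover seat 20241-p1 (g20). SUPPORT FILE (`--supports stmt-HodgeConjecture-19652`, helper; nothing
here closes an item; nothing here says HC is proved). Twin of `MarkmanPartnerTransportRMLocusClosed` (this seat, g12;
CONDITIONAL on the named fact `Griffiths1968_holomorphicHodgeSubbundles`) with that fact REPLACED by the binder
`(h𝒮 : IsQuasiProjectiveOver 𝒮)` on the total space of the family of surfaces: the fibre square `𝒮 ×_B 𝒮` is then
quasi-projective (`isQuasiProjectiveOver_familyPullback_of_isSeparated`, `B` separated as a quasi-projective
`ℂ`-scheme), so the cell's UNCONDITIONAL Lemma 5.13 `isInHodgeFiltration_fiberRestrict_of_mem_closure_of_isQuasiProjectiveOver`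
(`HodgeLociClosedOfQuasiProjective`, from `griffiths1968_holomorphicHodgeSubbundlesQP_holds`) applies to the
fibre-square family `familyPullback.snd π π ≫ π` (smooth projective of relative dimension `2 + 2`,
`Ring2.AbelianAll.isSmoothProjectiveFamily_familyPullback_snd_comp`).

* `isInHodgeFiltration_fiberRestrict_fibreSquare_of_mem_closure_of_isQuasiProjectiveOver` — for `π : 𝒮 → B` a
  smooth projective family of surfaces with `𝒮` quasi-projective over a smooth quasi-projective `B` of dimension `d`,
  an open `W ⊆ B(ℂ)`, a tube class `ξ ∈ H⁴` of the fibre-square family over `W`, a level `r` and `b ∈ W` in the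
  closure of `{b' ∈ W | ξ|_{S_{b'} × S_{b'}} ∈ Fʳ}`: `ξ|_{S_b × S_b} ∈ Fʳ` — ZERO named facts.

For the marked-K3 ∕ RM-component families of the line «RM-type descent» (projective families over quasi-projective
bases, e.g. restrictions of universal hypersurface or complete-intersection families) the quasi-projectivity of the
total space is available (`isQuasiProjectiveOver_total`, `…_totalSpz`, `…_familyPullback_of_isSeparated`), so the
analytic half of «the RM locus `D_θ` is algebraic» no longer consumes Griffiths 1968 as a named fact; the algebraic
half (Cattani–Deligne–Kaplan) is untouched.

References: C. Voisin, *Hodge Theory II* (2003), §5.3.1 Lemma 5.13; *Hodge Theory I* (2002), §10.2.1 Thm. 10.3;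
P. Griffiths, Amer. J. Math. 90 (1968), Thm. 1.1; R. Hartshorne, *Algebraic Geometry*, II Ex. 4.9 (products of
quasi-projective schemes).
-/

set_option linter.dupNamespace false

noncomputable section

open _root_.Topology _root_.Filter

namespace Summit.HodgeConjecture.HodgeConjecture.Theorems.MarkmanPartnerTransport.RMLocusClosed

open CategoryTheory
open Literature.AlgebraicTopology.SingularHomology Literature.AlgebraicGeometry.Motives
open Literature.AlgebraicGeometry.HodgeTheory
open Summit.HodgeConjecture.HodgeConjecture.Ring2.AbelianAll

/-- **The locus `{b : ξ|_{S_b × S_b} ∈ Fʳ}` of a flat class of `H⁴` of the fibre squares of a smooth projective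
family of surfaces with quasi-projective total space is CLOSED — no named fact** (Voisin II Lemma 5.13 for the
fibre-square family `𝒮 ×_B 𝒮 → B`; Griffiths' theorem is the tree's `griffiths1968_holomorphicHodgeSubbundlesQP_holds`):
for `π : 𝒮 → B` a smooth projective family of relative dimension `2`, `𝒮` quasi-projective, over a smooth
quasi-projective `ℂ`-scheme `B` of dimension `d`, an open `W ⊆ B(ℂ)`, a tube class `ξ` of degree `4` of the family
`familyPullback.snd π π ≫ π` over `W`, and `b ∈ W` in the closure of `{b' ∈ W | ξ|_{b'} ∈ Fʳ}`: `ξ|_b ∈ Fʳ`.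
[cite: VoisinHodgeII2003, §5.3.1 Lemma 5.13] [cite: VoisinHodgeI2002, §10.2.1 Thm. 10.3]
[cite: Griffiths1968PeriodsII, Thm. 1.1] -/
theorem isInHodgeFiltration_fiberRestrict_fibreSquare_of_mem_closure_of_isQuasiProjectiveOver
    {𝒮 B : SchemeOver ℂ} (π : 𝒮 ⟶ B) (d : ℕ) (hπ : IsSmoothProjectiveFamily π 2)
    (hB : IsQuasiProjectiveOver B) (h𝒮 : IsQuasiProjectiveOver 𝒮)
    [AlgebraicGeometry.SmoothOfRelativeDimension d B.hom]
    {W : Set (ComplexPoints B)} (hWo : IsOpen W)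
    (ξ : singularCohomology ℂ ℂ (tubeOver (familyPullback.snd π π ≫ π) W) (2 * 2)) (r : ℕ)
    {b : ComplexPoints B} (hbW : b ∈ W)
    (hcl : b ∈ closure {b' | ∃ hb' : b' ∈ W,
      IsInHodgeFiltration (2 + 2) (fiberOver (familyPullback.snd π π ≫ π) b') (2 * 2) r
        (fiberRestrict (familyPullback.snd π π ≫ π) hb' (2 * 2) ξ)}) :
    IsInHodgeFiltration (2 + 2) (fiberOver (familyPullback.snd π π ≫ π) b) (2 * 2) r
      (fiberRestrict (familyPullback.snd π π ≫ π) hbW (2 * 2) ξ) :=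
  haveI : AlgebraicGeometry.IsSeparated B.hom := hB.isVarietyPair_ofScheme.isSeparated
  isInHodgeFiltration_fiberRestrict_of_mem_closure_of_isQuasiProjectiveOver (familyPullback.snd π π ≫ π) (2 + 2)
    (2 * 2) d (isSmoothProjectiveFamily_familyPullback_snd_comp hπ hπ) hB
    (isQuasiProjectiveOver_familyPullback_of_isSeparated π π h𝒮 h𝒮) hWo ξ r hbW hcl

end Summit.HodgeConjecture.HodgeConjecture.Theorems.MarkmanPartnerTransport.RMLocusClosed

end
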